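import Mathlib
import Summits.Ventures.PercRepro.TriangleCapTwoTrianglesA

/-!
# PercRepro — THE TRIANGLE-COUNT FRONTIER OF THE SUB-DIAGONALS ON THE `K₄⁻`-FREE CLASS (p3, gen 36; part 47)

What the envelope's triangle cost (TriangleCapDenseEnvelope: `6 Σ_v d(v)² + (k − 6)|T₃| ≤ 6mk` for `k ≥ 6`,
`T₃` = the ordered triangles) gives for the sub-diagonal `r` of the closed form P3-TRIANGLE-CAP.md §10av on
`K₄⁻`-free graphs WITH triangles, with no accounting of their surroundings:

* `stability_of_triangles` — `6j ≤ |T₃|` and `r (k − r − 1) ≤ j (k − 6)` ⇒ `Σ_v d(v)² + r (k − r − 1) ≤ m·k`;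
* `stability_two_of_eighteen` — `r = 2`: three triangles (`|T₃| ≥ 18`) suffice for `k ≥ 12`;
* `stability_three_of_twentyfour` — `r = 3`: four triangles (`|T₃| ≥ 24`) suffice for `k ≥ 12`;
* `stability_two_of_three_triangles` — three distinct triangles in the vertex-disjointness form of
  TriangleCapTwoTrianglesA's `eighteen_le_card_triangles3`.

So on the `K₄⁻`-free class the cells two below the diagonal for `k ≥ 12` rest on the graphs with exactly one or two
triangles (where the census says the value is NOT attained: §10az(j)), three below on those with at most three;
the exact accounting of those cases (§10az(g)) is the open item.  Numbers: at `(8,13)` and `(9,15)` the closed-form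
value IS attained with a triangle (the first cell of each sub-diagonal, `k = r + 6`), so for `k < 12` the
inequality chain cannot close them.
Axioms: standard.
-/

namespace PercRepro

namespace TriangleCap

namespace C047

open Finset

variable {V : Type*} [Fintype V] [DecidableEq V]

/-- **THE TRIANGLE COST PAYS THE SUB-DIAGONAL `r` once `|T₃| ≥ 6j` with `j (k − 6) ≥ r (k − r − 1)`.** -/
theorem stability_of_triangles (D : SimpleGraph V) [DecidableRel D.Adj] (hK : K4mFree D)
    (hk : 6 ≤ Fintype.card V) (j r : ℕ) (hT : 6 * j ≤ (triangles3 D).card)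
    (hjr : r * (Fintype.card V - r - 1) ≤ j * (Fintype.card V - 6)) :
    ∑ v, deg D v * deg D v + r * (Fintype.card V - r - 1) ≤ D.edgeFinset.card * Fintype.card V := by
  have h := six_mul_sum_deg_sq_add_triangles_le D hK hk
  have h2 : (Fintype.card V - 6) * (6 * j) ≤ (Fintype.card V - 6) * (triangles3 D).card :=
    Nat.mul_le_mul_left _ hT
  have h3 : 6 * (r * (Fintype.card V - r - 1)) ≤ 6 * (j * (Fintype.card V - 6)) := Nat.mul_le_mul_left _ hjr
  have e : (Fintype.card V - 6) * (6 * j) = 6 * (j * (Fintype.card V - 6)) := by ring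
  rw [e] at h2
  omega

/-- `r = 2`: three triangles pay for `k ≥ 12`. -/
theorem stability_two_of_eighteen (D : SimpleGraph V) [DecidableRel D.Adj] (hK : K4mFree D)
    (hk : 12 ≤ Fintype.card V) (hT : 18 ≤ (triangles3 D).card) :
    ∑ v, deg D v * deg D v + 2 * (Fintype.card V - 3) ≤ D.edgeFinset.card * Fintype.card V := by
  have h := stability_of_triangles D hK (by omega) 3 2 (by omega) (by
    obtain ⟨k', hk'⟩ : ∃ k', Fintype.card V = k' + 12 := ⟨Fintype.card V - 12, by omega⟩
    rw [hk']
    have e1 : k' + 12 - 2 - 1 = k' + 9 := by omega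
    have e2 : k' + 12 - 6 = k' + 6 := by omega
    rw [e1, e2]
    omega)
  have e : Fintype.card V - 2 - 1 = Fintype.card V - 3 := by omega
  rw [e] at h
  exact h

/-- `r = 3`: four triangles pay for `k ≥ 12`. -/
theorem stability_three_of_twentyfour (D : SimpleGraph V) [DecidableRel D.Adj] (hK : K4mFree D)
    (hk : 12 ≤ Fintype.card V) (hT : 24 ≤ (triangles3 D).card) :
    ∑ v, deg D v * deg D v + 3 * (Fintype.card V - 4) ≤ D.edgeFinset.card * Fintype.card V := by
  have h := stability_of_triangles D hK (by omega) 4 3 (by omega) (by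
    obtain ⟨k', hk'⟩ : ∃ k', Fintype.card V = k' + 12 := ⟨Fintype.card V - 12, by omega⟩
    rw [hk']
    have e1 : k' + 12 - 3 - 1 = k' + 8 := by omega
    have e2 : k' + 12 - 6 = k' + 6 := by omega
    rw [e1, e2]
    omega)
  have e : Fintype.card V - 3 - 1 = Fintype.card V - 4 := by omega
  rw [e] at h
  exact h

/-- `r = 2`, `k ≥ 12`: three triangles, the third with a vertex off the first two, pay. -/
theorem stability_two_of_three_triangles (D : SimpleGraph V) [DecidableRel D.Adj] (hK : K4mFree D)
    (hk : 12 ≤ Fintype.card V) {u v w : V} (huv : D.Adj u v) (huw : D.Adj u w) (hvw : D.Adj v w)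
    {a b c : V} (hab : D.Adj a b) (hac : D.Adj a c) (hbc : D.Adj b c) (ha : ¬ (a = u ∨ a = v ∨ a = w))
    {x y z : V} (hxy : D.Adj x y) (hxz : D.Adj x z) (hyz : D.Adj y z)
    (hx : ¬ (x = u ∨ x = v ∨ x = w ∨ x = a ∨ x = b ∨ x = c)) :
    ∑ v, deg D v * deg D v + 2 * (Fintype.card V - 3) ≤ D.edgeFinset.card * Fintype.card V :=
  stability_two_of_eighteen D hK hk
    (eighteen_le_card_triangles3 D huv huw hvw hab hac hbc ha hxy hxz hyz hx)

end C047

end TriangleCap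

end PercRepro
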